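import Summits.Ventures.CertifiedManyBodySolver.Downfold.EmeryShapeTrueCornerBand
import Summits.Ventures.CertifiedManyBodySolver.Downfold.EmeryFermiScalePointsBi2212K26TrueCorners
import Summits.Ventures.CertifiedManyBodySolver.Downfold.EmeryFermiScalePointsBi2212K26VirtualCorners
import HarnessLib

/-!
# THE ONE-BAND FERMI-SURFACE SHAPE `t′/t` OF THE WHOLE TYPED 3BE BOX `emeryBoxBi2212K26Src (EmeryBoxesKSlicesH)` OVER ITS WHOLE FILLING BAND, AT ITS TWO TRUE CORNERS (true-corner rule, band form,
# §B.87 (j); router/EMERY-SHAPE-CORNERS.tsv «true band» rows)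

Venture CertifiedManyBodySolver, cell `pub/hubbard-downfold` (stage S1; INFLATION-RULES-3to1-B §B.87 (j)), seat hubbard-downfold-mod-4 (technique B, g35); namespace
`Summit.Ventures.CertifiedManyBodySolver.Downfold.Emery`. Everything PROVED (0 sorry; no new certificate — the end-filling brackets of the per-filling files are re-read).
WHAT THIS IS NOT: a statement about Bi₂Sr₂CaCu₂O₈₊δ plane ((K) source box) — the typed box is SCREENING-GRADE; `U = 0` one-body kinematics of the σ model (rigid band).

For EVERY one-body row of `[1.64, 2.127] × [1.34, 1.409] × [0.647, 0.701] × [0.133, 0.173]` eV AND EVERY filling `ν ∈ [2/5, 21/50]` the one-band `t′/t` lies in **[-0.3042, -0.263]**: the true-corner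
squeeze `fsRatio_fermiEnergyOf_trueCorner_lower_band` / `…_upper_band` (`EmeryShapeTrueCornerBand`: slab windows `[pL, qL] = [4517/2500, 4787/2500]`, `[pU, qU] = [4423/2500, 18689/10000]`, regime `qT = 20393/10000`
certified at the END fillings; margin constants lower slab M_b 1.9525 / M_c 0.0, upper slab M_b 2.6472 / M_c 0.0), read at the true corners over their band windows
`[18177/10000, 3753/2000]` (monotone) and `[2257/1250, 4631/2500]` (monotone) (`fermiEnergyOf_mem_Icc_of_band`). Comparator (certified, g19 sub-box device, n_H band): [-0.3062,-0.2608] (n_H band).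

Sources: three-band model [HybertsenSchluterChristensen1989, Eq. (1)]; [AndersenEtAl1995, §6]; box rows as cited in the typed object's file.
-/

noncomputable section

namespace Summit.Ventures.CertifiedManyBodySolver.Downfold.Emery

open Real Set

/-- **filling band ν ∈ [2/5, 21/50] (n_H = 1.20 (ν = 2/5) … n_H = 1.16 (ν = 21/50)): for every row of the box AND every filling of the band the one-band Fermi-surface `t′/t` (object E) lies in `[-0.3042, -0.263]` — between its values at the two TRUE corners** (band form of the true-corner rule; margins by `norm_num`). [folklore] -/
theorem bi2212K26Box_fsRatio_true_band {Δ a b c ν : ℝ} (hΔ : Δ ∈ Icc ((41 : ℝ) / 25) ((2127 : ℝ) / 1000)) (ha : a ∈ Icc ((67 : ℝ) / 50) ((1409 : ℝ) / 1000)) (hb : b ∈ Icc ((647 : ℝ) / 1000) ((701 : ℝ) / 1000)) (hc : c ∈ Icc ((133 : ℝ) / 1000) ((173 : ℝ) / 1000)) (hν : ν ∈ Icc ((2 : ℝ) / 5) ((21 : ℝ) / 50)) :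
    fsRatio Δ a b c (fermiEnergyOf Δ a b c ν) ∈ Icc ((-1521 : ℝ) / 5000) ((-263 : ℝ) / 1000) := by
  have hSL := (fermiEnergyOf_of_pointBracketCheck truePt_Bi2212K26SL_nH120_br (by norm_num) (by norm_num) (by norm_num) (ν := (2/5 : ℝ)) (by push_cast; exact ⟨le_rfl, le_rfl⟩)).2
  have hAlo := (fermiEnergyOf_of_pointBracketCheck virtPt_Bi2212K26Alo_nH116_br (by norm_num) (by norm_num) (by norm_num) (ν := (21/50 : ℝ)) (by push_cast; exact ⟨le_rfl, le_rfl⟩)).2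
  have hTop := (fermiEnergyOf_of_pointBracketCheck virtPt_Bi2212K26H_nH116_br (by norm_num) (by norm_num) (by norm_num) (ν := (21/50 : ℝ)) (by push_cast; exact ⟨le_rfl, le_rfl⟩)).2
  have hSU := (fermiEnergyOf_of_pointBracketCheck truePt_Bi2212K26SU_nH120_br (by norm_num) (by norm_num) (by norm_num) (ν := (2/5 : ℝ)) (by push_cast; exact ⟨le_rfl, le_rfl⟩)).2
  have hQU := (fermiEnergyOf_of_pointBracketCheck truePt_Bi2212K26QU_nH116_br (by norm_num) (by norm_num) (by norm_num) (ν := (21/50 : ℝ)) (by push_cast; exact ⟨le_rfl, le_rfl⟩)).2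
  have hTL1 := (fermiEnergyOf_of_pointBracketCheck truePt_Bi2212K26TL_nH120_br (by norm_num) (by norm_num) (by norm_num) (ν := (2/5 : ℝ)) (by push_cast; exact ⟨le_rfl, le_rfl⟩)).2
  have hTL2 := (fermiEnergyOf_of_pointBracketCheck truePt_Bi2212K26TL_nH116_br (by norm_num) (by norm_num) (by norm_num) (ν := (21/50 : ℝ)) (by push_cast; exact ⟨le_rfl, le_rfl⟩)).2
  have hTH1 := (fermiEnergyOf_of_pointBracketCheck truePt_Bi2212K26TH_nH120_br (by norm_num) (by norm_num) (by norm_num) (ν := (2/5 : ℝ)) (by push_cast; exact ⟨le_rfl, le_rfl⟩)).2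
  have hTH2 := (fermiEnergyOf_of_pointBracketCheck truePt_Bi2212K26TH_nH116_br (by norm_num) (by norm_num) (by norm_num) (ν := (21/50 : ℝ)) (by push_cast; exact ⟨le_rfl, le_rfl⟩)).2
  push_cast at hSL hAlo hTop hSU hQU hTL1 hTL2 hTH1 hTH2
  norm_num at hSL hAlo hTop hSU hQU hTL1 hTL2 hTH1 hTH2
  obtain ⟨hΔl, hΔu⟩ := hΔ
  obtain ⟨hal, hau⟩ := ha
  have hTL := fermiEnergyOf_mem_Icc_of_band (Δ := ((41 : ℝ) / 25)) (a := ((67 : ℝ) / 50)) (b := ((701 : ℝ) / 1000)) (c := ((173 : ℝ) / 1000)) (e₁ := ((18177 : ℝ) / 10000)) (e₂ := ((3753 : ℝ) / 2000)) (by norm_num) (by norm_num) (by norm_num) (by norm_num) (by norm_num) hν (by norm_num) hTL1.1 hTL2.2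
  have hTH := fermiEnergyOf_mem_Icc_of_band (Δ := ((2127 : ℝ) / 1000)) (a := ((1409 : ℝ) / 1000)) (b := ((647 : ℝ) / 1000)) (c := ((133 : ℝ) / 1000)) (e₁ := ((2257 : ℝ) / 1250)) (e₂ := ((4631 : ℝ) / 2500)) (by norm_num) (by norm_num) (by norm_num) (by norm_num) (by norm_num) hν (by norm_num) hTH1.1 hTH2.2
  constructor
  · have hlow := fsRatio_fermiEnergyOf_trueCorner_lower_band (Δ₁ := ((41 : ℝ) / 25)) (a₁ := ((67 : ℝ) / 50)) (b₁ := ((647 : ℝ) / 1000)) (b₂ := ((701 : ℝ) / 1000)) (c₁ := ((133 : ℝ) / 1000)) (c₂ := ((173 : ℝ) / 1000)) (ν₁ := ((2 : ℝ) / 5)) (ν₂ := ((21 : ℝ) / 50))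
      (pL := ((4517 : ℝ) / 2500)) (qL := ((4787 : ℝ) / 2500)) (Mb := ((781 : ℝ) / 400)) (Mc := (0 : ℝ)) (by norm_num) hΔl (by norm_num) hal (by norm_num) hb (by norm_num) hc (by norm_num) (by norm_num) hν (by norm_num)
      (by norm_num) hSL.1 hAlo.2 (by norm_num) (by norm_num [fsD, fsN]) (by norm_num) (by norm_num) (by norm_num [fsD, fsN]) (by norm_num) (by norm_num [dopingDisc]) (by norm_num [fsD, fsN])
    refine le_trans ?_ hlow
    have hw := (fsRatio_mem_Icc_on_window_of_dopingDisc_nonpos (Δ := ((41 : ℝ) / 25)) (a := ((67 : ℝ) / 50)) (b := ((701 : ℝ) / 1000)) (c := ((173 : ℝ) / 1000))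
      (p := ((18177 : ℝ) / 10000)) (q := ((3753 : ℝ) / 2000)) (by norm_num) (by norm_num) (by norm_num) (by norm_num) (by norm_num) (by norm_num) (by norm_num) (by norm_num [dopingDisc]) hTL).1
    refine le_trans ?_ hw
    norm_num [fsRatio, fsD, fsN]
  · have hup := fsRatio_fermiEnergyOf_trueCorner_upper_band (Δ₁ := ((41 : ℝ) / 25)) (Δ₂ := ((2127 : ℝ) / 1000)) (a₁ := ((67 : ℝ) / 50)) (a₂ := ((1409 : ℝ) / 1000)) (b₁ := ((647 : ℝ) / 1000)) (b₂ := ((701 : ℝ) / 1000)) (c₁ := ((133 : ℝ) / 1000)) (c₂ := ((173 : ℝ) / 1000)) (ν₁ := ((2 : ℝ) / 5)) (ν₂ := ((21 : ℝ) / 50))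
      (pU := ((4423 : ℝ) / 2500)) (qU := ((18689 : ℝ) / 10000)) (qT := ((20393 : ℝ) / 10000)) (Mb := ((3309 : ℝ) / 1250)) (Mc := (0 : ℝ)) (by norm_num) ⟨hΔl, hΔu⟩ (by norm_num) ⟨hal, hau⟩ (by norm_num) hb (by norm_num) hc (by norm_num) (by norm_num) hν (by norm_num)
      hTop.2 (by norm_num) (by norm_num) hSU.1 hQU.2 (by norm_num) (by norm_num [fsD, fsN]) (by norm_num) (by norm_num) (by norm_num [fsD, fsN]) (by norm_num) (by norm_num) (by norm_num [fsD, fsN])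
    refine le_trans hup ?_
    have hw := (fsRatio_mem_Icc_on_window_of_dopingDisc_nonpos (Δ := ((2127 : ℝ) / 1000)) (a := ((1409 : ℝ) / 1000)) (b := ((647 : ℝ) / 1000)) (c := ((133 : ℝ) / 1000))
      (p := ((2257 : ℝ) / 1250)) (q := ((4631 : ℝ) / 2500)) (by norm_num) (by norm_num) (by norm_num) (by norm_num) (by norm_num) (by norm_num) (by norm_num) (by norm_num [dopingDisc]) hTH).2
    refine le_trans hw ?_
    norm_num [fsRatio, fsD, fsN]

end Summit.Ventures.CertifiedManyBodySolver.Downfold.Emery
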